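import Summits.CriticalPhenomena.SAWScalingLimit.Theses.SAWSpinMonotone
import Summits.CriticalPhenomena.SAWScalingLimit.Theorems.SAWSpinMonotoneSpinMonotoneAdjacentPortDefs
import Summits.CriticalPhenomena.SAWScalingLimit.Theorems.SAWSpinMonotoneSpinMonotoneNormSqThreeTerm
import Summits.CriticalPhenomena.SAWScalingLimit.Theorems.SAWSpinMonotoneSpinMonotoneThreeTermViolation
import Summits.CriticalPhenomena.SAWScalingLimit.Theorems.SAWSpinMonotoneSpinMonotoneThreeTermAntitone
import Summits.CriticalPhenomena.SAWScalingLimit.Theorems.SAWSpinMonotoneSpinMonotoneAdjacentWinding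

/-!
# The adjacent-port reduction of the crux `SpinMonotone` (line `Sketch`, stmt-CriticalPhenomena-16769)

Route `SAWSpinMonotone`, crux `Summit.CriticalPhenomena.SAWScalingLimit.Theses.SAWSpinMonotone.SpinMonotone` (rank 2). This file
composes, sorry-free, the landed stubs `stub_normSq_threeTerm` (p172578), `stub_threeTermViolation` (p172573),
`stub_threeTermAntitone` (p172540) and `stub_adjacentWinding` (p172568) of the registered skeleton `Cruxes/SpinMonotone/Lines/Sketch.lean`
over the vocabulary module `…AdjacentPortDefs` into the REDUCTION of the crux in the boundary-adjacent regime: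

* `portSum_eq_threeTerm` — at an adjacent configuration the port sum of the crux is the three-term trigonometric sum
  `m₀e^{-isεπ/3} + m₁e^{-isεπ} + m₂e^{-is5επ/3}` of the port masses (`ε = ±1`);
* `adjacentPortInequality_of_spinMonotone : SpinMonotone → AdjacentPortInequality` — the crux forces `4m₀m₂ ≤ m₁(m₀ + m₂)` at
  every adjacent configuration (registered glue sub-goal of the line);
* `antitoneOn_adjacent_iff` — at an adjacent configuration the crux's antitonicity is EQUIVALENT to that inequality.

Consequently the crux restricted to adjacent targets is decided by the two positive generating functions `m₁ = portMass … p`,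
`m₂ = portMass … q` (`m₀ = x_c`), computable by transfer matrices on strip-shaped domains (card
`Cruxes/SpinMonotone/Ideas/notched-strip-transfer-matrix.md`), and a single configuration with `m₁(m₀+m₂) < 4m₀m₂` refutes the crux
(`Theorems/SAWSpinMonotoneSpinMonotone/Negative/SpinMonotoneFalseOfAdjacentPortWitness.lean`).
Sources: H. Duminil-Copin, S. Smirnov, Ann. of Math. 175 (2012) 1653–1665 (arXiv:1007.0575), §1–2. Deliberately NOT here: any
claim about the inequality itself (registered stub `stub_adjacentPortInequality`, open) or about non-adjacent targets.
-/

noncomputable section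

namespace Summit.CriticalPhenomena.SAWScalingLimit.Cruxes.SpinMonotone.AdjacentPort

open Literature.Probability.LatticeModels
open Literature.Probability.RandomPlanarGeometry Literature.Probability.RandomPlanarGeometry.SAW
open Summit.CriticalPhenomena.SAWScalingLimit.Theses.SAWSpinMonotone (SpinMonotone)
open Summit.CriticalPhenomena.SAWScalingLimit.Cruxes.ArrivalFlattening.SpinChord (portMass portMass_nonneg)

/-- If every walk `a → z` of a domain has the same winding `W`, the observable at `z` is the mass times the phase `e^{-isW}`.
[cite: DuminilCopinSmirnov2012, Definition 1] -/
theorem obs_eq_of_winding_const {Λ' : Finset HexVertex} {a z : Sym2 HexVertex} {W : ℝ}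
    (h : ∀ γ : HexMidEdgeSAW Λ' a z, γ.winding = W) (s : ℝ) :
    hexParafermionicObservable Λ' a hexCriticalFugacity s z =
      ((∑ γ : HexMidEdgeSAW Λ' a z, hexCriticalFugacity ^ γ.length : ℝ) : ℂ) *
        Complex.exp (-Complex.I * (s : ℂ) * (W : ℂ)) := by
  rw [hexParafermionicObservable_def, Complex.ofReal_sum, Finset.sum_mul]
  refine Finset.sum_congr rfl fun γ _ => ?_
  rw [HexMidEdgeSAW.weight, h γ, Complex.ofReal_pow, mul_comm]

/-- `{u, w₁}` with `u ∉ Λ ∋ w₁`, `u ∼ w₁`, is a boundary mid-edge. [cite: DuminilCopinSmirnov2012, §2 (domains)] -/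
theorem mem_boundary_of {Λ : Finset HexVertex} {u w₁ : HexVertex} (hu : u ∉ Λ) (hw₁ : w₁ ∈ Λ)
    (huw : hexGraph.Adj u w₁) : s(u, w₁) ∈ hexDomainBoundary Λ :=
  ⟨(SimpleGraph.mem_edgeSet hexGraph).2 huw, u, w₁, rfl, hw₁, hu⟩

/-- **The port sum at an adjacent target is the three-term sum of the port masses** (from `stub_adjacentWinding`).
[cite: DuminilCopinSmirnov2012, §2 and proof of Lemma 1] -/
theorem portSum_eq_threeTerm {Λ : Finset HexVertex} {u w₁ v p q : HexVertex} (hc : AdjacentConfig Λ u w₁ v p q) :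
    ∃ ε : ℝ, (ε = 1 ∨ ε = -1) ∧ ∀ s : ℝ,
      hexParafermionicObservable (Λ.erase v) s(u, w₁) hexCriticalFugacity s s(v, w₁) +
          hexParafermionicObservable (Λ.erase v) s(u, w₁) hexCriticalFugacity s s(v, p) +
          hexParafermionicObservable (Λ.erase v) s(u, w₁) hexCriticalFugacity s s(v, q) =
        (portMass Λ s(u, w₁) v w₁ : ℂ) * Complex.exp (-Complex.I * (s : ℂ) * ((ε * (Real.pi / 3) : ℝ) : ℂ)) +
          (portMass Λ s(u, w₁) v p : ℂ) * Complex.exp (-Complex.I * (s : ℂ) * ((ε * Real.pi : ℝ) : ℂ)) +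
          (portMass Λ s(u, w₁) v q : ℂ) *
            Complex.exp (-Complex.I * (s : ℂ) * ((ε * (5 * Real.pi / 3) : ℝ) : ℂ)) := by
  obtain ⟨hΛ, hu, hw₁, hv, huw, hvw, hvp, hvq, n₁, n₂, n₃, hfar⟩ := hc
  obtain ⟨ε, hε, H₀, H₁, H₂⟩ := stub_adjacentWinding Λ u w₁ v p q hΛ hu hw₁ hv huw hvw hvp hvq n₁ n₂ n₃ hfar
  refine ⟨ε, hε, fun s => ?_⟩
  rw [obs_eq_of_winding_const H₀ s, obs_eq_of_winding_const H₁ s, obs_eq_of_winding_const H₂ s]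
  rfl

/-- **`SpinMonotone` at an adjacent configuration forces the quadratic form `Q` of the port masses to be antitone.**
[cite: DuminilCopinSmirnov2012, Definition 1] -/
theorem antitoneOn_Q_of_spinMonotone (hFM : SpinMonotone) {Λ : Finset HexVertex} {u w₁ v p q : HexVertex}
    (hc : AdjacentConfig Λ u w₁ v p q) :
    AntitoneOn (fun s : ℝ => portMass Λ s(u, w₁) v w₁ ^ 2 + portMass Λ s(u, w₁) v p ^ 2 +
        portMass Λ s(u, w₁) v q ^ 2 +
        2 * (portMass Λ s(u, w₁) v w₁ * portMass Λ s(u, w₁) v p +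
          portMass Λ s(u, w₁) v p * portMass Λ s(u, w₁) v q) * Real.cos (2 * Real.pi * s / 3) +
        2 * (portMass Λ s(u, w₁) v w₁ * portMass Λ s(u, w₁) v q) * Real.cos (4 * Real.pi * s / 3))
      (Set.Icc (0 : ℝ) (3 / 2)) := by
  obtain ⟨ε, hε, hsum⟩ := portSum_eq_threeTerm hc
  obtain ⟨hΛ, hu, hw₁, hv, huw, hvw, hvp, hvq, n₁, n₂, n₃, -⟩ := hc
  have hanti := hFM Λ hΛ _ (mem_boundary_of hu hw₁ huw) v hv w₁ p q hvw hvp hvq n₁ n₂ n₃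
  intro s hs t ht hst
  have key := hanti hs ht hst
  simp only at key
  rw [hsum t, hsum s] at key
  have e₁ := stub_normSq_threeTerm (portMass Λ s(u, w₁) v w₁) (portMass Λ s(u, w₁) v p) (portMass Λ s(u, w₁) v q) ε t hε
  have e₂ := stub_normSq_threeTerm (portMass Λ s(u, w₁) v w₁) (portMass Λ s(u, w₁) v p) (portMass Λ s(u, w₁) v q) ε s hε
  simp only
  rw [← e₁, ← e₂]
  exact pow_le_pow_left₀ (norm_nonneg _) key 2

/-- **`SpinMonotone → AdjacentPortInequality`**: the crux forces `4·m(w₁)·m(q) ≤ m(p)·(m(w₁) + m(q))` at every adjacent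
configuration of every simply connected domain (registered glue sub-goal of line `Sketch`).
[cite: DuminilCopinSmirnov2012, Definition 1] -/
theorem adjacentPortInequality_of_spinMonotone : SpinMonotone → AdjacentPortInequality := by
  intro hFM Λ u w₁ v p q hc
  have hQ := antitoneOn_Q_of_spinMonotone hFM hc
  refine le_of_not_gt fun hlt => ?_
  exact stub_threeTermViolation _ _ _ (portMass_nonneg _ _ _ _) (portMass_nonneg _ _ _ _) (portMass_nonneg _ _ _ _) hlt hQ

/-- **At an adjacent configuration the crux's antitonicity is equivalent to the adjacent-port inequality.**
[cite: DuminilCopinSmirnov2012, Definition 1] -/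
theorem antitoneOn_adjacent_iff {Λ : Finset HexVertex} {u w₁ v p q : HexVertex} (hc : AdjacentConfig Λ u w₁ v p q) :
    AntitoneOn (fun s : ℝ =>
      ‖hexParafermionicObservable (Λ.erase v) s(u, w₁) hexCriticalFugacity s s(v, w₁) +
          hexParafermionicObservable (Λ.erase v) s(u, w₁) hexCriticalFugacity s s(v, p) +
          hexParafermionicObservable (Λ.erase v) s(u, w₁) hexCriticalFugacity s s(v, q)‖)
      (Set.Icc (0 : ℝ) (3 / 2)) ↔
    4 * portMass Λ s(u, w₁) v w₁ * portMass Λ s(u, w₁) v q ≤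
      portMass Λ s(u, w₁) v p * (portMass Λ s(u, w₁) v w₁ + portMass Λ s(u, w₁) v q) := by
  obtain ⟨ε, hε, hsum⟩ := portSum_eq_threeTerm hc
  set m₀ := portMass Λ s(u, w₁) v w₁
  set m₁ := portMass Λ s(u, w₁) v p
  set m₂ := portMass Λ s(u, w₁) v q
  have h₀ : 0 ≤ m₀ := portMass_nonneg _ _ _ _
  have h₁ : 0 ≤ m₁ := portMass_nonneg _ _ _ _
  have h₂ : 0 ≤ m₂ := portMass_nonneg _ _ _ _
  -- the modulus of the port sum, squared, is `Q`
  have hQ : ∀ s : ℝ, ‖hexParafermionicObservable (Λ.erase v) s(u, w₁) hexCriticalFugacity s s(v, w₁) +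
      hexParafermionicObservable (Λ.erase v) s(u, w₁) hexCriticalFugacity s s(v, p) +
      hexParafermionicObservable (Λ.erase v) s(u, w₁) hexCriticalFugacity s s(v, q)‖ ^ 2 =
      m₀ ^ 2 + m₁ ^ 2 + m₂ ^ 2 + 2 * (m₀ * m₁ + m₁ * m₂) * Real.cos (2 * Real.pi * s / 3) +
        2 * (m₀ * m₂) * Real.cos (4 * Real.pi * s / 3) := by
    intro s; rw [hsum s]; exact stub_normSq_threeTerm m₀ m₁ m₂ ε s hε
  constructor
  · intro hanti
    refine le_of_not_gt fun hlt => stub_threeTermViolation m₀ m₁ m₂ h₀ h₁ h₂ hlt ?_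
    intro s hs t ht hst
    have key := hanti hs ht hst
    simp only at key ⊢
    rw [← hQ t, ← hQ s]
    exact pow_le_pow_left₀ (norm_nonneg _) key 2
  · intro hineq s hs t ht hst
    have key := stub_threeTermAntitone m₀ m₁ m₂ h₀ h₁ h₂ hineq hs ht hst
    simp only at key ⊢
    rw [← hQ t, ← hQ s] at key
    exact le_of_pow_le_pow_left₀ two_ne_zero (norm_nonneg _) key

end Summit.CriticalPhenomena.SAWScalingLimit.Cruxes.SpinMonotone.AdjacentPort

end
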